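import Summits.Ventures.HSemireg.WedgeHankelKernelColumnSpace
import Summits.Ventures.HSemireg.WedgeHankelTranspose

/-!
# Venture HSemireg — THE HANKEL RANK PROFILE IS UNIMODAL: for every coefficient sequence `q`, **`rank H_k(q) ≤ rank H_{k+1}(q)` whenever `2k + 1 ≤ N`** (every field) — a column relation
# `Σ a_s (column s of H_{k+1}) = 0` yields TWO relations among the columns of `H_k` (padded and shifted), and the shifted relation of highest support is new; with D11's palindrome
# `rank H_k = rank H_{N−k}` the profile is non-decreasing up to the middle and non-increasing after it

HONEST FRAMING. Part of the Lean index of the computation cell `pub-hsemireg` (seat p10 gen 25, Sunday typer «UNIFORM-IN-n»).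
LINEAR ALGEBRA OF HANKEL (catalecticant) MATRICES over a field ONLY: no variety, no cohomology theory, no sheaf, no Ext group and no semiregularity map is constructed here; nothing here says
that HC / HC_CM / HC_AV holds; no Literature fact is declared or used.  Custodian versions as in `WedgeHankelSiegelIdeal` (1/3); the dictionary (`rank H_k(q)` = the Hankel factor of THEOREM H)
is QUOTED, never asserted.  The monotonicity was first CHECKED by brute force (`GF(2)`, `GF(3)`, `N ≤ 8`, every `q`; script `monotone.py` in the seat folder), then proved.

WHAT IS IN THE TREE.  th-7's `hankel1`; D11 (`WedgeHankelTranspose`) `rank_hankel1_symm` (`rank H_k = rank H_{N−k}`); Mathlib `Matrix.rank`, `LinearMap.finrank_range_add_finrank_ker`,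
`Matrix.rank_le_height`, `Submodule.finrank_lt_finrank_of_lt`, `Submodule.equivMapOfInjective`.
THIS FILE (namespace `Summit.Ventures.HSemireg.Wedge.HankelOuter` continued; imports M14 for the environment and D11):
* §457 **`finrank_ker_hankel1_succ_add_one_le`** (`k + 1 ≤ N`, `ker H_{k+1} ≠ 0`: `dim ker H_{k+1} + 1 ≤ dim ker H_k` — PAD and SHIFT the column relations; the shift of a relation of
  maximal support is not a padded relation), **`rank_hankel1_le_rank_succ`** (`2k + 1 ≤ N`: `rank H_k(q) ≤ rank H_{k+1}(q)`), **`rank_hankel1_mono_left`** (`k ≤ j`, `2j ≤ N + 1`: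
  `rank H_k ≤ rank H_j`), **`rank_hankel1_succ_le_rank_of_ge`** (`N ≤ 2k + 1`, `k + 1 ≤ N`: `rank H_{k+1}(q) ≤ rank H_k(q)`, by the palindrome), `rank_hankel1_anti_right`
  (`N + 1 ≤ 2k`, `k ≤ j ≤ N`: `rank H_j ≤ rank H_k`).
READING: THE RANK ROW OF THEOREM H IS UNIMODAL AND PALINDROMIC (and 1-Lipschitz, N13 keyed) for EVERY class, in EVERY regime — the shape of the census tables is a theorem, not an
observation.  Nothing Ext-side.  New names only.
-/

open Module
open scoped Matrix

namespace Summit.Ventures.HSemireg.Wedge.HankelOuter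

open Summit.Ventures.HSemireg.Wedge Summit.Ventures.HSemireg.Wedge.Kunneth Summit.Ventures.HSemireg.Wedge.Hankel
  Summit.Ventures.HSemireg.Wedge.BasisFree Summit.Ventures.HSemireg.Wedge.HankelSiegel Summit.Ventures.HSemireg.Wedge.HankelSiegelIdeal
  Summit.Ventures.HSemireg.Wedge.KunnethKernel Summit.Ventures.HSemireg.Wedge.HankelFrameChange Summit.Ventures.HSemireg.Wedge.KernelDuality
  Summit.Ventures.HSemireg.Wedge.HankelSecant

variable (K : Type*) [Field K] {N : ℕ}

/-! ## §457. Column relations of `H_{k+1}` pad and shift to column relations of `H_k` -/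

/-- **`dim ker H_{k+1}(q) + 1 ≤ dim ker H_k(q)`** when `k + 1 ≤ N` and `H_{k+1}(q)` HAS a column relation: every relation `a` among the columns of `H_{k+1}` (windows of length `k+2`)
gives the PADDED relation `(a, 0)` and the SHIFTED relation `(0, a)` among the columns of `H_k` (windows of length `k+1`); padding is injective, and the shift of a relation whose support
reaches the highest index `m` attained by any relation is not a padded relation (its coordinate `m + 1` is non-zero). -/
theorem finrank_ker_hankel1_succ_add_one_le {k : ℕ} (hk : k + 1 ≤ N) (q : ℕ → K) (hker : LinearMap.ker (hankel1 K N (k + 1) q).mulVecLin ≠ ⊥) :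
    finrank K ↥(LinearMap.ker (hankel1 K N (k + 1) q).mulVecLin) + 1 ≤ finrank K ↥(LinearMap.ker (hankel1 K N k q).mulVecLin) := by
  classical
  set A := hankel1 K N (k + 1) q with hA
  set B := hankel1 K N k q with hB
  -- the pad and shift matrices
  set E : Matrix (Fin (N + 1 - k)) (Fin (N + 1 - (k + 1))) K := Matrix.of fun s t => if (s : ℕ) = (t : ℕ) then (1 : K) else 0 with hE
  set S : Matrix (Fin (N + 1 - k)) (Fin (N + 1 - (k + 1))) K := Matrix.of fun s t => if (s : ℕ) = (t : ℕ) + 1 then (1 : K) else 0 with hS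
  -- their products with `B` are the row-truncations of `A`
  have hBE : B * E = A.submatrix (Fin.castSucc : Fin (k + 1) → Fin (k + 1 + 1)) id := by
    ext i t
    rw [Matrix.mul_apply, Matrix.submatrix_apply, Finset.sum_eq_single (⟨(t : ℕ), by omega⟩ : Fin (N + 1 - k))]
    · simp only [hE, hB, hA, Matrix.of_apply, if_true, mul_one, hankel1, id, Fin.val_castSucc]
    · intro s _ hs
      rw [hE, Matrix.of_apply, if_neg (fun e => hs (Fin.ext e)), mul_zero]
    · intro h; exact absurd (Finset.mem_univ _) h
  have hBS : B * S = A.submatrix (Fin.succ : Fin (k + 1) → Fin (k + 1 + 1)) id := by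
    ext i t
    rw [Matrix.mul_apply, Matrix.submatrix_apply, Finset.sum_eq_single (⟨(t : ℕ) + 1, by omega⟩ : Fin (N + 1 - k))]
    · simp only [hS, hB, hA, Matrix.of_apply, if_true, mul_one, hankel1, id, Fin.val_succ]
      congr 1
      omega
    · intro s _ hs
      rw [hS, Matrix.of_apply, if_neg (fun e => hs (Fin.ext e)), mul_zero]
    · intro h; exact absurd (Finset.mem_univ _) h
  -- truncating the rows of `A` kills a relation of `A`
  have hsub : ∀ (r : Fin (k + 1) → Fin (k + 1 + 1)) (v : Fin (N + 1 - (k + 1)) → K), A *ᵥ v = 0 → (A.submatrix r id) *ᵥ v = 0 := by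
    intro r v hv
    funext i
    have := congrFun hv (r i)
    rw [Pi.zero_apply] at this ⊢
    rw [← this]
    rfl
  have hPad : ∀ a ∈ LinearMap.ker A.mulVecLin, E.mulVecLin a ∈ LinearMap.ker B.mulVecLin := by
    intro a ha
    rw [LinearMap.mem_ker, Matrix.mulVecLin_apply] at ha ⊢
    rw [Matrix.mulVecLin_apply, Matrix.mulVec_mulVec, hBE, hsub _ a ha]
  have hShift : ∀ a ∈ LinearMap.ker A.mulVecLin, S.mulVecLin a ∈ LinearMap.ker B.mulVecLin := by
    intro a ha
    rw [LinearMap.mem_ker, Matrix.mulVecLin_apply] at ha ⊢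
    rw [Matrix.mulVecLin_apply, Matrix.mulVec_mulVec, hBS, hsub _ a ha]
  -- coordinates of padded / shifted vectors
  have hEapp : ∀ (a : Fin (N + 1 - (k + 1)) → K) (s : Fin (N + 1 - k)),
      (E *ᵥ a) s = if h : (s : ℕ) < N + 1 - (k + 1) then a ⟨(s : ℕ), h⟩ else 0 := by
    intro a s
    simp only [Matrix.mulVec, dotProduct]
    by_cases h : (s : ℕ) < N + 1 - (k + 1)
    · rw [dif_pos h, Finset.sum_eq_single (⟨(s : ℕ), h⟩ : Fin (N + 1 - (k + 1)))]
      · rw [hE, Matrix.of_apply, if_pos rfl, one_mul]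
      · intro t _ ht; rw [hE, Matrix.of_apply, if_neg (fun e => ht (Fin.ext e.symm)), zero_mul]
      · intro hh; exact absurd (Finset.mem_univ _) hh
    · rw [dif_neg h]
      exact Finset.sum_eq_zero fun t _ => by rw [hE, Matrix.of_apply, if_neg (by have := t.2; omega), zero_mul]
  have hSapp : ∀ (a : Fin (N + 1 - (k + 1)) → K) (t : Fin (N + 1 - (k + 1))),
      (S *ᵥ a) (⟨(t : ℕ) + 1, by omega⟩ : Fin (N + 1 - k)) = a t := by
    intro a t
    simp only [Matrix.mulVec, dotProduct]
    rw [Finset.sum_eq_single t]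
    · rw [hS, Matrix.of_apply, if_pos rfl, one_mul]
    · intro t' _ ht'; rw [hS, Matrix.of_apply, if_neg (fun e => ht' (Fin.ext (by simp only at e; omega))), zero_mul]
    · intro hh; exact absurd (Finset.mem_univ _) hh
  -- padding is injective
  have hEinj : Function.Injective E.mulVecLin := by
    intro a a' h
    funext t
    have := congrFun h (⟨(t : ℕ), by omega⟩ : Fin (N + 1 - k))
    rw [Matrix.mulVecLin_apply, Matrix.mulVecLin_apply, hEapp, hEapp, dif_pos t.2, dif_pos t.2] at this
    exact this
  -- the highest index carried by a relation of `A`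
  obtain ⟨a₁, ha₁, hne₁⟩ := (Submodule.ne_bot_iff _).mp hker
  obtain ⟨t₁, ht₁⟩ : ∃ t, a₁ t ≠ 0 := by
    by_contra hall
    simp only [not_exists, not_not] at hall
    exact hne₁ (funext hall)
  set I := Finset.univ.filter (fun t : Fin (N + 1 - (k + 1)) => ∃ a ∈ LinearMap.ker A.mulVecLin, a t ≠ 0) with hI
  have hIne : I.Nonempty := ⟨t₁, by rw [hI, Finset.mem_filter]; exact ⟨Finset.mem_univ _, a₁, ha₁, ht₁⟩⟩
  set m := I.max' hIne with hm
  have hmI : m ∈ I := Finset.max'_mem I hIne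
  obtain ⟨a₀, ha₀, ha₀m⟩ : ∃ a ∈ LinearMap.ker A.mulVecLin, a m ≠ 0 := by
    have := hmI; rw [hI, Finset.mem_filter] at this; exact this.2
  have hvan : ∀ a ∈ LinearMap.ker A.mulVecLin, ∀ t : Fin (N + 1 - (k + 1)), (m : ℕ) < t → a t = 0 := by
    intro a ha t hmt
    by_contra hne
    have htI : t ∈ I := by rw [hI, Finset.mem_filter]; exact ⟨Finset.mem_univ _, a, ha, hne⟩
    have := Finset.le_max' I t htI
    rw [← hm] at this
    exact absurd hmt (not_lt.mpr this)
  -- the shifted relation of `a₀` is not a padded relation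
  have hnot : S.mulVecLin a₀ ∉ (LinearMap.ker A.mulVecLin).map E.mulVecLin := by
    rintro ⟨a, ha, hEq⟩
    have h1 := congrFun hEq (⟨(m : ℕ) + 1, by omega⟩ : Fin (N + 1 - k))
    rw [Matrix.mulVecLin_apply, Matrix.mulVecLin_apply, hEapp, hSapp] at h1
    by_cases hlt : (m : ℕ) + 1 < N + 1 - (k + 1)
    · rw [dif_pos hlt, hvan a ha ⟨(m : ℕ) + 1, hlt⟩ (by simp only; omega)] at h1
      exact ha₀m h1.symm
    · rw [dif_neg hlt] at h1
      exact ha₀m h1.symm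
  -- conclude: `map E (ker A) < ker B`
  have hle : (LinearMap.ker A.mulVecLin).map E.mulVecLin ≤ LinearMap.ker B.mulVecLin := by
    rintro _ ⟨a, ha, rfl⟩; exact hPad a ha
  have hlt : (LinearMap.ker A.mulVecLin).map E.mulVecLin < LinearMap.ker B.mulVecLin :=
    lt_of_le_of_ne hle (fun e => hnot (e ▸ hShift a₀ ha₀))
  have h1 := Submodule.finrank_lt_finrank_of_lt hlt
  rw [← (Submodule.equivMapOfInjective _ hEinj (LinearMap.ker A.mulVecLin)).finrank_eq] at h1
  omega

/-- **THE RANK PROFILE IS NON-DECREASING UP TO THE MIDDLE: `rank H_k(q) ≤ rank H_{k+1}(q)` whenever `2k + 1 ≤ N`** (every field, every `q`). If `H_{k+1}` has a column relation, the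
kernels grow by at least one while the column count grows by exactly one; if not, `rank H_{k+1} = N − k ≥ k + 1 ≥ rank H_k`. -/
theorem rank_hankel1_le_rank_succ {k : ℕ} (h2k : 2 * k + 1 ≤ N) (q : ℕ → K) :
    (hankel1 K N k q).rank ≤ (hankel1 K N (k + 1) q).rank := by
  have hk : k + 1 ≤ N := by omega
  have hA := LinearMap.finrank_range_add_finrank_ker (hankel1 K N (k + 1) q).mulVecLin
  have hB := LinearMap.finrank_range_add_finrank_ker (hankel1 K N k q).mulVecLin
  rw [finrank_fintype_fun_eq_card, Fintype.card_fin] at hA hB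
  rw [Matrix.rank, Matrix.rank]
  by_cases hker : LinearMap.ker (hankel1 K N (k + 1) q).mulVecLin = ⊥
  · rw [hker, finrank_bot] at hA
    have hrows : (hankel1 K N k q).rank ≤ k + 1 := Matrix.rank_le_height _
    rw [Matrix.rank] at hrows
    omega
  · have h := finrank_ker_hankel1_succ_add_one_le K hk q hker
    omega

/-- **`rank H_k(q) ≤ rank H_j(q)` for `k ≤ j` with `2j ≤ N + 1`** (iterate up to the middle). -/
theorem rank_hankel1_mono_left {k j : ℕ} (hkj : k ≤ j) (hj : 2 * j ≤ N + 1) (q : ℕ → K) :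
    (hankel1 K N k q).rank ≤ (hankel1 K N j q).rank := by
  obtain ⟨d, rfl⟩ := Nat.exists_eq_add_of_le hkj
  induction d with
  | zero => simp
  | succ d ih =>
    rw [show k + (d + 1) = k + d + 1 by omega]
    exact (ih (by omega) (by omega)).trans (rank_hankel1_le_rank_succ K (by omega) q)

/-- **THE RANK PROFILE IS NON-INCREASING AFTER THE MIDDLE: `rank H_{k+1}(q) ≤ rank H_k(q)` whenever `N ≤ 2k + 1` and `k + 1 ≤ N`** (the palindrome `rank H_k = rank H_{N−k}`, D11). -/
theorem rank_hankel1_succ_le_rank_of_ge {k : ℕ} (hN : N ≤ 2 * k + 1) (hk : k + 1 ≤ N) (q : ℕ → K) :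
    (hankel1 K N (k + 1) q).rank ≤ (hankel1 K N k q).rank := by
  rw [rank_hankel1_symm K (m := N) (k := k + 1) hk q, rank_hankel1_symm K (m := N) (k := k) (by omega) q,
    show N - k = N - (k + 1) + 1 by omega]
  exact rank_hankel1_le_rank_succ K (by omega) q

/-- **`rank H_j(q) ≤ rank H_k(q)` for `k ≤ j ≤ N` with `N + 1 ≤ 2k`** (iterate down from the middle). -/
theorem rank_hankel1_anti_right {k j : ℕ} (hkj : k ≤ j) (hj : j ≤ N) (hk : N + 1 ≤ 2 * k) (q : ℕ → K) :
    (hankel1 K N j q).rank ≤ (hankel1 K N k q).rank := by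
  obtain ⟨d, rfl⟩ := Nat.exists_eq_add_of_le hkj
  induction d with
  | zero => simp
  | succ d ih =>
    rw [show k + (d + 1) = k + d + 1 by omega]
    exact (rank_hankel1_succ_le_rank_of_ge K (by omega) (by omega) q).trans (ih (by omega) (by omega))

end Summit.Ventures.HSemireg.Wedge.HankelOuter
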